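import Summits.BirchSwinnertonDyer.BirchSwinnertonDyer.Theses.EisensteinPrimes
import Literature.NumberTheory.EllipticCurves.SteinWuthrich2013.SplitMultCanonicalHolds
import HarnessLib

/-!
# Route `EisensteinPrimes` (rung K5): the aside item `SteinWuthrichSplitMultCanonicalExists` CLOSED
# by the Literature discharge `SteinWuthrich2013.exists_isSplitMultCanonical_holds`

Item stmt-BirchSwinnertonDyer-19474 (aside, rank 9; conjunct 18 of `PublishedInputs`,
stmt-BirchSwinnertonDyer-19037) is, by name, the Literature constant
`Literature.NumberTheory.EllipticCurves.SteinWuthrich2013.exists_isSplitMultCanonical`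
(Stein–Wuthrich 2013 §4.2: existence of the canonical `p`-adic height datum at a split
multiplicative prime `p ≠ 2`). That named fact is a THEOREM of the tree:
`SteinWuthrich2013.exists_isSplitMultCanonical_holds`
(`Literature/NumberTheory/EllipticCurves/SteinWuthrich2013/SplitMultCanonicalHolds.lean`, cell
`bsd-eis` seat `k5-c4` g3, via `exists_isSplitMultCanonical_of_thetaRelation` and Silverman's theta
relation on Tate curves `TateCurve.tate_thetaRelation`). This file only restates that theorem at the
FULLY-QUALIFIED item type, so the ledger item closes `proved`; nothing is asserted, no hypothesis.

Honest framing: closes ONE cite-only published input of rung K5 of `BirchSwinnertonDyer` (an aside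
item of route `EisensteinPrimes`); no crux, no label or count of the cell's partition moves; BSD is
proved for no curve by this file. Cell `bsd-eis`, seat `bsd-eis-k5-ty` g14 (typer).
[cite: SteinWuthrich2013, §4.2 (pp. 15–16)] [cite: SilvermanATAEC1994, Prop. V.3.2 (b) (PDF p. 399)]
-/

set_option autoImplicit false
set_option linter.dupNamespace false

namespace Summit.BirchSwinnertonDyer.BirchSwinnertonDyer.Theorems

/-- **Item `SteinWuthrichSplitMultCanonicalExists` holds** (Stein–Wuthrich 2013 §4.2, split
multiplicative case: `∀ W p, p ≠ 2 → ∀ Dq : TateParameterData W p, ∃ Dh, IsSplitMultCanonical Dh Dq`),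
by the Literature theorem `SteinWuthrich2013.exists_isSplitMultCanonical_holds`.
[cite: SteinWuthrich2013, §4.2 (pp. 15–16)] -/
theorem steinWuthrichSplitMultCanonicalExists_holds :
    Summit.BirchSwinnertonDyer.BirchSwinnertonDyer.Theses.EisensteinPrimes.SteinWuthrichSplitMultCanonicalExists :=
  Literature.NumberTheory.EllipticCurves.SteinWuthrich2013.exists_isSplitMultCanonical_holds

end Summit.BirchSwinnertonDyer.BirchSwinnertonDyer.Theorems
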